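import Summits.BirchSwinnertonDyer.BirchSwinnertonDyer.Theorems.EisensteinPrimesSecondaryBirchReading
import HarnessLib

/-!
# Route `EisensteinPrimes`, line `mudescent`, stub `stub_lambdaCountWeak_offLocus` (crux 3
# `MazurMCOnCellB`, stmt-BirchSwinnertonDyer-19033): the secondary Birch reading at a
# MULTIPLICATIVE prime `p ‖ N` (class X2) — two Birch sums of THE Mazur–Tate–Teitelbaum function give
# `ord_{T=0} L_p ≤ k`, and at a SPLIT prime the SIMPLICITY of the exceptional zero (helper; closes nothing)

Seat `bsd-eis-lam-a` g14. Sequel of `EisensteinPrimesSecondaryBirchReading` (`order_le_of_two_twists`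
for any `(f, α)` with the twisted clause): here `α = a_p = ±1` is supplied by the X2 dichotomy
`IsSplitMultPAdicLFunctionOf` / `IsMultPAdicLFunctionOf f p (−1)` exactly as in
`EisensteinPrimesX2AnalyticLambdaCertificate` (`exists_interpolation_of_dichotomy`), so the statements
are about `|ϖ·Birch(χ)|` with no `α`. At a SPLIT prime the constant term vanishes by the interpolation
package itself (`L(0) = (1 − 1)·[0]⁺_f = 0`, the exceptional zero), so `k = 1` gives
**`ord_{T=0} L_p(E,T) = 1` — the exceptional zero is SIMPLE — from two twisted values**, a per-pair
numerical stand-in for the Greenberg–Stevens non-vanishing `𝓛_p(E)·L(E,1) ≠ 0` that the line's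
composition takes as the named fact `hGS` (PublishedInputs conjunct 20). THEOREMS ONLY; no definition,
no named fact; nothing about any curve is asserted; closes nothing.
References: [MazurTateTeitelbaum1986Invent] §I.13–I.15; [GreenbergStevens1993]; HOME/bsd-eis/lam-a-g14/lam-a-MEMO-14.md.
-/

set_option linter.dupNamespace false
set_option autoImplicit false

noncomputable section

open scoped Classical MatrixGroups ModularForm

open PowerSeries CongruenceSubgroup WeierstrassCurve
  Literature.NumberTheory.EllipticCurves
  Literature.NumberTheory.EllipticCurves.ModularForms
  Summit.BirchSwinnertonDyer.Rank1Residual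
  Summit.BirchSwinnertonDyer.Rank1Residual.X1.MuLambda
  Summit.BirchSwinnertonDyer.Rank1Residual.Iwasawa
  Summit.BirchSwinnertonDyer.BirchSwinnertonDyer.Theorems.EisensteinPrimesX2AnalyticLambdaCertificate
  Summit.BirchSwinnertonDyer.BirchSwinnertonDyer.Theorems.EisensteinPrimesSecondaryBirchReading

namespace Summit.BirchSwinnertonDyer.BirchSwinnertonDyer.Theorems.EisensteinPrimesSecondaryBirchReadingMult

variable {p : ℕ} [hp : Fact p.Prime] {N : ℕ} {f : CuspForm (Gamma0 N) 2}
  {W : WeierstrassCurve ℚ} {L : PowerSeries ℚ_[p]}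

/-- **Multiplicative `p` (class X2): two Birch sums of THE Mazur–Tate–Teitelbaum function give
`‖[T^k]G‖ = 1/p`, `[T^k]L ≠ 0` and `ord_{T=0} L ≤ k`** (`α = a_p = ±1` from the split/non-split
dichotomy; integral model `ι G = ϖ·L ≠ 0`; `χ₁` determining `λ = V < φ(pⁿ⁺¹)`, `χ₂` undetermined with
value `p^{−(φ(p^{m+1}) + k)}`, `k < φ(p^{m+1})`, `φ(p^{m+1}) + k < V`).
[cite: MazurTateTeitelbaum1986Invent, §I.13–I.14] [cite: Washington1997, §7.1–7.2] -/
theorem mult_order_le_of_two_twists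
    (hLs : W.HasSplitMultiplicativeReductionAtPrime p → IsSplitMultPAdicLFunctionOf f p L)
    (hLn : ¬ W.HasSplitMultiplicativeReductionAtPrime p → IsMultPAdicLFunctionOf f p (-1) L)
    {G : IwasawaAlgebra p} {ϖ : ℚ_[p]} (hG : iwasawaToPowerSeries p G = PowerSeries.C ϖ * L)
    (hG0 : G ≠ 0) {n : ℕ} (χ₁ : DirichletCharacter ℂ_[p] (p ^ (n + 1 + cyclotomicExponent p)))
    (hχ₁ : χ₁.IsPrimitive) (heven₁ : χ₁.Even) (hord₁ : ∃ j : ℕ, orderOf χ₁ = p ^ j) {V : ℕ}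
    (hV : V < Nat.totient (p ^ (n + 1)))
    (h₁ : ‖algebraMap ℚ_[p] ℂ_[p] ϖ * ratTwistedSymbolSum f χ₁‖ ^ Nat.totient (p ^ (n + 1)) =
      ((p : ℝ)⁻¹) ^ V)
    {m : ℕ} (χ₂ : DirichletCharacter ℂ_[p] (p ^ (m + 1 + cyclotomicExponent p)))
    (hχ₂ : χ₂.IsPrimitive) (heven₂ : χ₂.Even) (hord₂ : ∃ j : ℕ, orderOf χ₂ = p ^ j) {k : ℕ}
    (hk : k < Nat.totient (p ^ (m + 1))) (hkV : Nat.totient (p ^ (m + 1)) + k < V)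
    (h₂ : ‖algebraMap ℚ_[p] ℂ_[p] ϖ * ratTwistedSymbolSum f χ₂‖ ^ Nat.totient (p ^ (m + 1)) =
      ((p : ℝ)⁻¹) ^ (Nat.totient (p ^ (m + 1)) + k)) :
    ‖PowerSeries.coeff k G‖ = (p : ℝ)⁻¹ ∧ PowerSeries.coeff k L ≠ 0 ∧ L.order ≤ k := by
  obtain ⟨α, hα, hI⟩ := exists_interpolation_of_dichotomy (W := W) hLs hLn
  have e : ∀ (j : ℕ) (χ : DirichletCharacter ℂ_[p] (p ^ j)),
      ‖algebraMap ℚ_[p] ℂ_[p] ϖ * (algebraMap ℚ_[p] ℂ_[p] (α⁻¹ ^ j) * ratTwistedSymbolSum f χ)‖ =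
        ‖algebraMap ℚ_[p] ℂ_[p] ϖ * ratTwistedSymbolSum f χ‖ := by
    intro j χ
    rw [norm_mul, norm_mul, hα, one_mul, ← norm_mul]
  have h₁' := h₁; rw [← e] at h₁'
  have h₂' := h₂; rw [← e] at h₂'
  exact order_le_of_two_twists hI hG hG0 χ₁ hχ₁ heven₁ hord₁ hV h₁' χ₂ hχ₂ heven₂ hord₂ hk hkV h₂'

/-- **At a SPLIT multiplicative prime the exceptional zero is SIMPLE, from two Birch sums.** The
split package gives `L(0) = 0`; with `k = 1` above, `ord_{T=0} L_p(E,T) = 1`.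
[cite: MazurTateTeitelbaum1986Invent, §I.15] [cite: GreenbergStevens1993, Thm.] -/
theorem split_order_eq_one_of_two_twists (hsplit : W.HasSplitMultiplicativeReductionAtPrime p)
    (hLs : W.HasSplitMultiplicativeReductionAtPrime p → IsSplitMultPAdicLFunctionOf f p L)
    {G : IwasawaAlgebra p} {ϖ : ℚ_[p]} (hG : iwasawaToPowerSeries p G = PowerSeries.C ϖ * L)
    (hG0 : G ≠ 0) {n : ℕ} (χ₁ : DirichletCharacter ℂ_[p] (p ^ (n + 1 + cyclotomicExponent p)))
    (hχ₁ : χ₁.IsPrimitive) (heven₁ : χ₁.Even) (hord₁ : ∃ j : ℕ, orderOf χ₁ = p ^ j) {V : ℕ}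
    (hV : V < Nat.totient (p ^ (n + 1)))
    (h₁ : ‖algebraMap ℚ_[p] ℂ_[p] ϖ * ratTwistedSymbolSum f χ₁‖ ^ Nat.totient (p ^ (n + 1)) =
      ((p : ℝ)⁻¹) ^ V)
    {m : ℕ} (χ₂ : DirichletCharacter ℂ_[p] (p ^ (m + 1 + cyclotomicExponent p)))
    (hχ₂ : χ₂.IsPrimitive) (heven₂ : χ₂.Even) (hord₂ : ∃ j : ℕ, orderOf χ₂ = p ^ j)
    (hk : 1 < Nat.totient (p ^ (m + 1))) (hkV : Nat.totient (p ^ (m + 1)) + 1 < V)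
    (h₂ : ‖algebraMap ℚ_[p] ℂ_[p] ϖ * ratTwistedSymbolSum f χ₂‖ ^ Nat.totient (p ^ (m + 1)) =
      ((p : ℝ)⁻¹) ^ (Nat.totient (p ^ (m + 1)) + 1)) :
    L.order = 1 := by
  have hLn : ¬ W.HasSplitMultiplicativeReductionAtPrime p → IsMultPAdicLFunctionOf f p (-1) L :=
    fun h ↦ absurd hsplit h
  obtain ⟨-, hne, hle⟩ := mult_order_le_of_two_twists hLs hLn hG hG0 χ₁ hχ₁ heven₁ hord₁ hV h₁
    χ₂ hχ₂ heven₂ hord₂ hk hkV h₂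
  -- constant term: `L(0) = (1 - 1⁻¹)·… = 0` from the split package read as `IsMultPAdicLFunctionOf f p 1 L`
  have hmult : IsMultPAdicLFunctionOf f p 1 L := (isMultPAdicLFunctionOf_one_iff L).mpr (hLs hsplit)
  have hL0 : PowerSeries.constantCoeff L = 0 := by rw [hmult.2.1]; simp
  refine le_antisymm hle ?_
  have h1 : ((1 : ℕ) : ℕ∞) ≤ L.order := by
    refine PowerSeries.nat_le_order L 1 fun i hi ↦ ?_
    have hi0 : i = 0 := by omega
    subst hi0
    rw [PowerSeries.coeff_zero_eq_constantCoeff]; exact hL0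
  simpa using h1

end Summit.BirchSwinnertonDyer.BirchSwinnertonDyer.Theorems.EisensteinPrimesSecondaryBirchReadingMult

end
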